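import Literature.NumberTheory.EllipticCurves.OpenImageMazurCharacterProofs
import Literature.NumberTheory.Congruences.QuadraticCharactersMinusThreeAndFive
import HarnessLib

/-!
# Conductor-supported Kronecker–Weber for characters of `Γ_ℚ`, and `−3` is a square modulo a squarefree product of primes
# `≡ 1 (mod 3)` — two general lemmas for the `p = 13` voidness of the `d_K = −3` sliver of crux r3 `GordTwoBranchIMC`

Cell `bsd-schneider-ideate`, seat `bsd-schneider-door-c5` (prover, generation 34; `--supports` 19177).  Route `SchneiderFreeAdditiveX3`
(K1 door), crux r3 `GordTwoBranchIMC` (item 19177), registered stub `stub_sliver` (`KYReadSliver`).  PARTITION: board row B6 ∩ X3 ∩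
sst-twist, `r = 1`, (G-ord, `e = 2`) half — ASSEMBLY support; types-the-object-of nothing; closes nothing (BSD NOT advanced).
bears_on: K1-door (item 19177).

WHY.  Generation 34's sliver-scope record (`…GordCellSliverScope.lean`) locates the support of the `d_K = −3` sliver inside
`{7, 13, 19, 37, 43, 67, 163}` (door-c3: `p ≡ 1 (mod 3)`; Mazur: rational `p`-isogenies).  The companion file
`…GordCellSliverVoidThirteen.lean` removes `13` by an arithmetic obstruction — no elliptic curve over `ℚ` with a rational 13-isogeny has
all its bad primes `≡ 1 (mod 3)` — whose two general inputs are proved here, in the currency of the tree's Mazur 1978 §5 file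
(`Literature/…/OpenImageMazurCharacterProofs.lean`):

* §1 `exists_factor_level_of_unramified` — ONE-PRIME STRIPPING: if `ψ = β ∘ χ_m` (`χ_m` the mod-`m` cyclotomic character of `Γ_ℚ`),
  `m = p^{k+1} d` with `p ∤ d`, and `ψ` is trivial on the inertia groups above `p`, then `ψ = β′ ∘ χ_d`: the inertia at `p` is mapped by
  `χ_m` ONTO `ker((ℤ/m)ˣ → (ℤ/d)ˣ)` (the tree's `exists_mem_inertia_modNCyclotomicCharacter_eq`, total ramification of `ℚ(ζ_{p^{k+1}})`),
  so `β` kills that kernel and descends along the surjection `(ℤ/m)ˣ → (ℤ/d)ˣ` (`χ_m mod d = χ_d`, `unitsMap_modNCyclotomicCharacter`).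
* §2 `exists_factor_level_of_pow_eq_one` — TAME STRIPPING: if every value of `β` is killed by `n` and `p ∤ n`, then `β` kills the
  `p`-group `ker((ℤ/p^{k+1}d)ˣ → (ℤ/pd)ˣ)` (order `p^k`), so `ψ = β′ ∘ χ_{pd}`.
* §3 `exists_squarefree_level_of_unramified_outside` — **conductor-supported Kronecker–Weber**: a character `ψ : Γ_ℚ → M` with open
  kernel, values killed by `n`, trivial on the inertia groups above every prime OUTSIDE a set `S` of primes coprime to `n`, factors as
  `β ∘ χ_m` with `m` SQUAREFREE and every prime factor of `m` in `S` (the tree's `Mazur1978.exists_comp_modNCyclotomicCharacter_eq` gives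
  some level `m`; strong induction on `m` with §1/§2).  Washington, *Cyclotomic Fields*, Thm. 14.1 with the conductor read off the
  ramification (ibid. Ch. 3); Neukirch, *ANT*, VII (5.6)/(6.?) conductor–discriminant.
* §4 `isSquare_neg_three_zmod_of_squarefree` — `−3` is a square modulo every squarefree `m` all of whose prime factors are `≡ 1 (mod 3)`
  (Hardy–Wright Thm. 96 at each prime, the tree's `SmallQuadraticResidues.isSquare_neg_three_iff`; Chinese remainder theorem,
  Mathlib `ZMod.chineseRemainder`).

HONEST FRAMING: general, unconditional lemmas of algebraic number theory (the only non-Mathlib inputs are the tree's PROVED theorems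
`KroneckerWeber_holds`, `exists_mem_inertia_modNCyclotomicCharacter_eq`, `unitsMap_modNCyclotomicCharacter`); no definition, no named fact,
no `sorry`; nothing here mentions elliptic curves or BSD.
References: Washington, *Introduction to Cyclotomic Fields*, Thm. 14.1, Prop. 2.3, Ch. 3 [Washington1997]; Serre, *Local Fields*, I §7
Prop. 22 (b) [SerreLocalFields1979]; Hardy–Wright Thm. 96 [HardyWright2008]; Mazur 1978 §5 Lemma 5.2 (the method) [Mazur1978].
-/

set_option autoImplicit false
-- `Summit.<P>.<Sub>` repeats `BirchSwinnertonDyer` by the tree's layout convention (D-0017)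
set_option linter.dupNamespace false

noncomputable section

open scoped Classical

open NumberField IsDedekindDomain IsDedekindDomain.HeightOneSpectrum Field
  Literature.NumberTheory.GaloisRepresentations Literature.NumberTheory.EllipticCurves

namespace Summit.BirchSwinnertonDyer.BirchSwinnertonDyer.Theorems.SchneiderFreeAdditiveX3.GaloisCharacterConductor

/-! ### §1 Stripping a prime at which the character is unramified -/

/-- **One-prime stripping.**  Let `ψ : Γ_ℚ → M` factor as `β ∘ χ_m` through the mod-`m` cyclotomic character, `m = p^{k+1}·d` with
`p ∤ d`, and suppose `ψ` is trivial on the inertia groups `I_𝔓 ≤ Γ_ℚ` at the primes `𝔓` of `\bar ℤ` above `p`.  Then `ψ` factors through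
`χ_d`.  Proof: `χ_m` maps the inertia above `p` ONTO `ker((ℤ/m)ˣ → (ℤ/d)ˣ)` (`exists_mem_inertia_modNCyclotomicCharacter_eq`), so `β`
kills that kernel and descends along the surjection `(ℤ/m)ˣ → (ℤ/d)ˣ`; `χ_m mod d = χ_d`.
[cite: Washington1997, Thm. 14.1 and Prop. 2.3] [cite: SerreLocalFields1979, Ch. I §7 Prop. 22(b)] -/
theorem exists_factor_level_of_unramified {M : Type*} [CommGroup M] (ψ : absoluteGaloisGroup ℚ →* M)
    {m : ℕ} [NeZero m] (β : (ZMod m)ˣ →* M) (hβ : ∀ σ : absoluteGaloisGroup ℚ, β (modNCyclotomicCharacter ℚ m σ) = ψ σ)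
    {p k d : ℕ} [hp : Fact p.Prime] (hm : m = p ^ (k + 1) * d) (hd : ¬ p ∣ d)
    (hunr : ∀ (v : HeightOneSpectrum (𝓞 ℚ)), Rat.HeightOneSpectrum.natGenerator v = p →
      ∀ 𝔓 ∈ v.primesAbove, ∀ τ ∈ 𝔓.inertia (absoluteGaloisGroup ℚ), ψ τ = 1) :
    ∃ (_ : NeZero d) (β' : (ZMod d)ˣ →* M), ∀ σ : absoluteGaloisGroup ℚ, β' (modNCyclotomicCharacter ℚ d σ) = ψ σ := by
  haveI hd0 : NeZero d := ⟨fun h0 => NeZero.ne m (by rw [hm, h0, mul_zero])⟩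
  have hdm : d ∣ m := Dvd.intro_left _ hm.symm
  -- the place of `ℚ` at `p` and a prime of `\bar ℤ` above it
  set v : HeightOneSpectrum (𝓞 ℚ) := Rat.HeightOneSpectrum.primesEquiv.symm ⟨p, hp.out⟩ with hvdef
  have hgen : Rat.HeightOneSpectrum.natGenerator v = p := by
    change ((Rat.HeightOneSpectrum.primesEquiv v : Nat.Primes) : ℕ) = p
    rw [hvdef, Equiv.apply_symm_apply]
  obtain ⟨𝔓, h𝔓⟩ := HeightOneSpectrum.primesAbove_nonempty v
  -- `β` kills `ker((ℤ/m)ˣ → (ℤ/d)ˣ)`: its elements are cyclotomic characters of inertia elements at `p`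
  have hle : (ZMod.unitsMap hdm).ker ≤ β.ker := by
    intro a ha
    rw [MonoidHom.mem_ker] at ha ⊢
    obtain ⟨τ, hτ, hτa⟩ := exists_mem_inertia_modNCyclotomicCharacter_eq hm hd hgen h𝔓 (a := a) ha
    rw [← hτa, hβ τ]
    exact hunr v hgen 𝔓 h𝔓 τ hτ
  have hsurj : Function.Surjective (ZMod.unitsMap hdm) := ZMod.unitsMap_surjective hdm
  have hs : Function.RightInverse (Function.surjInv hsurj) (ZMod.unitsMap hdm) := Function.rightInverse_surjInv hsurj
  refine ⟨hd0, MonoidHom.liftOfRightInverse (ZMod.unitsMap hdm) (Function.surjInv hsurj) hs ⟨β, hle⟩, fun σ => ?_⟩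
  rw [← Mazur1978.unitsMap_modNCyclotomicCharacter hdm σ,
    MonoidHom.liftOfRightInverse_comp_apply (ZMod.unitsMap hdm) (Function.surjInv hsurj) hs ⟨β, hle⟩]
  exact hβ σ

/-! ### §2 Stripping a higher power of a tame prime -/

/-- The kernel of `(ℤ/p^{k+1}d)ˣ → (ℤ/pd)ˣ` (`p ∤ d`) has order `p^k`. [folklore] -/
theorem natCard_ker_unitsMap_eq_pow {p k d m : ℕ} (hp : p.Prime) (hm : m = p ^ (k + 1) * d) (hd : ¬ p ∣ d) [NeZero m]
    [NeZero (p * d)] (hdvd : p * d ∣ m) : Nat.card (ZMod.unitsMap hdvd).ker = p ^ k := by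
  have hcop : (p ^ (k + 1)).Coprime d := Nat.Coprime.pow_left _ ((Nat.Prime.coprime_iff_not_dvd hp).mpr hd)
  have hcop1 : p.Coprime d := (Nat.Prime.coprime_iff_not_dvd hp).mpr hd
  have hφm : Nat.totient m = p ^ k * (p - 1) * Nat.totient d := by
    rw [hm, Nat.totient_mul hcop, Nat.totient_prime_pow_succ hp]
  have hφpd : Nat.totient (p * d) = (p - 1) * Nat.totient d := by
    rw [Nat.totient_mul hcop1, Nat.totient_prime hp]
  have h1 := Subgroup.card_mul_index (ZMod.unitsMap hdvd).ker
  rw [Subgroup.index_ker, MonoidHom.range_eq_top.mpr (ZMod.unitsMap_surjective hdvd), Subgroup.card_top,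
    Nat.card_eq_fintype_card (α := (ZMod (p * d))ˣ), ZMod.card_units_eq_totient,
    Nat.card_eq_fintype_card (α := (ZMod m)ˣ), ZMod.card_units_eq_totient, hφm, hφpd, mul_assoc] at h1
  have hpos : 0 < (p - 1) * Nat.totient d :=
    Nat.mul_pos (by have := hp.two_le; omega) (Nat.totient_pos.mpr (Nat.pos_of_ne_zero fun h0 => hd (h0 ▸ dvd_zero p)))
  exact Nat.eq_of_mul_eq_mul_right hpos h1

/-- **Tame stripping.**  Let `ψ : Γ_ℚ → M` factor as `β ∘ χ_m`, `m = p^{k+1}·d` with `p ∤ d`, and suppose every value of `β` is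
killed by an exponent `n` prime to `p`.  Then `ψ` factors through `χ_{pd}`: `β` kills the `p`-group `ker((ℤ/m)ˣ → (ℤ/pd)ˣ)` (order
`p^k`, `natCard_ker_unitsMap_eq_pow`) since `gcd(p^k, n) = 1`, and descends; `χ_m mod pd = χ_{pd}`.  (For a character with values in
`𝔽_N^×`, `n = N − 1`: tame ramification has conductor exponent `≤ 1`.) [cite: Washington1997, Thm. 14.1 and Ch. 3 (conductor of a Dirichlet character)] -/
theorem exists_factor_level_of_pow_eq_one {M : Type*} [CommGroup M] (ψ : absoluteGaloisGroup ℚ →* M)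
    {m : ℕ} [NeZero m] (β : (ZMod m)ˣ →* M) (hβ : ∀ σ : absoluteGaloisGroup ℚ, β (modNCyclotomicCharacter ℚ m σ) = ψ σ)
    {n : ℕ} (hn : ∀ x : (ZMod m)ˣ, β x ^ n = 1)
    {p k d : ℕ} (hp : p.Prime) (hm : m = p ^ (k + 1) * d) (hd : ¬ p ∣ d) (hcop : p.Coprime n) :
    ∃ (_ : NeZero (p * d)) (β' : (ZMod (p * d))ˣ →* M),
      (∀ x : (ZMod (p * d))ˣ, β' x ^ n = 1) ∧ ∀ σ : absoluteGaloisGroup ℚ, β' (modNCyclotomicCharacter ℚ (p * d) σ) = ψ σ := by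
  have hd0 : d ≠ 0 := fun h0 => NeZero.ne m (by rw [hm, h0, mul_zero])
  haveI hpd : NeZero (p * d) := ⟨Nat.mul_ne_zero hp.ne_zero hd0⟩
  have hdvd : p * d ∣ m := ⟨p ^ k, by rw [hm, pow_succ]; ring⟩
  -- `β` kills the kernel, a `p`-group
  have hcard := natCard_ker_unitsMap_eq_pow hp hm hd hdvd
  have hle : (ZMod.unitsMap hdvd).ker ≤ β.ker := by
    intro a ha
    rw [MonoidHom.mem_ker]
    have hpow1 : β a ^ p ^ k = 1 := by
      have h2 : (⟨a, ha⟩ : (ZMod.unitsMap hdvd).ker) ^ Nat.card (ZMod.unitsMap hdvd).ker = 1 := pow_card_eq_one'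
      rw [hcard] at h2
      have h3 := congrArg (fun y : (ZMod.unitsMap hdvd).ker => β (y : (ZMod m)ˣ)) h2
      simpa only [SubgroupClass.coe_pow, map_pow, OneMemClass.coe_one, map_one] using h3
    have hpow2 : β a ^ n = 1 := hn a
    have hcop' : (p ^ k).Coprime n := Nat.Coprime.pow_left _ hcop
    have h4 := pow_gcd_eq_one.mpr ⟨hpow1, hpow2⟩
    rwa [Nat.Coprime.gcd_eq_one hcop', pow_one] at h4
  have hsurj : Function.Surjective (ZMod.unitsMap hdvd) := ZMod.unitsMap_surjective hdvd
  have hs : Function.RightInverse (Function.surjInv hsurj) (ZMod.unitsMap hdvd) := Function.rightInverse_surjInv hsurj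
  set β' : (ZMod (p * d))ˣ →* M := MonoidHom.liftOfRightInverse (ZMod.unitsMap hdvd) (Function.surjInv hsurj) hs ⟨β, hle⟩
    with hβ'def
  have hβ' : ∀ x : (ZMod m)ˣ, β' (ZMod.unitsMap hdvd x) = β x := fun x =>
    MonoidHom.liftOfRightInverse_comp_apply (ZMod.unitsMap hdvd) (Function.surjInv hsurj) hs ⟨β, hle⟩ x
  refine ⟨hpd, β', fun x => ?_, fun σ => ?_⟩
  · obtain ⟨y, rfl⟩ := hsurj x
    rw [hβ']
    exact hn y
  · rw [← Mazur1978.unitsMap_modNCyclotomicCharacter hdvd σ, hβ']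
    exact hβ σ

/-! ### §3 Conductor-supported Kronecker–Weber -/

/-- **Kronecker–Weber with the level supported on the ramification.**  Let `ψ : Γ_ℚ → M` (commutative) have open kernel and values
killed by `n` (`ψ(σ)ⁿ = 1`), and let `S` be a set of primes, each prime to `n`, such that `ψ` is trivial on the inertia groups
`I_𝔓 ≤ Γ_ℚ` at every prime `𝔓` of `\bar ℤ` above a rational prime OUTSIDE `S`.  Then `ψ = β ∘ χ_m` for a SQUAREFREE level `m` all of
whose prime factors lie in `S` (and `β` has values killed by `n`).  Proof: the tree's `Mazur1978.exists_comp_modNCyclotomicCharacter_eq`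
(Kronecker–Weber) gives some level; strip the primes outside `S` by §1 and the repeated primes of `S` by §2, by strong induction on the
level.  This is "the conductor of `ψ` divides the product of the ramified primes" for a tamely ramified character of `Γ_ℚ`.
[cite: Washington1997, Thm. 14.1, Prop. 2.3 and Ch. 3] [cite: SerreLocalFields1979, Ch. I §7 Prop. 22(b)] -/
theorem exists_squarefree_level_of_unramified_outside {M : Type*} [CommGroup M] (ψ : absoluteGaloisGroup ℚ →* M)
    (hker : IsOpen ((ψ.ker : Subgroup (absoluteGaloisGroup ℚ)) : Set (absoluteGaloisGroup ℚ)))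
    {n : ℕ} (hn : ∀ σ : absoluteGaloisGroup ℚ, ψ σ ^ n = 1)
    (S : Set ℕ) (hS : ∀ p ∈ S, p.Coprime n)
    (hunr : ∀ p : ℕ, p.Prime → p ∉ S → ∀ (v : HeightOneSpectrum (𝓞 ℚ)), Rat.HeightOneSpectrum.natGenerator v = p →
      ∀ 𝔓 ∈ v.primesAbove, ∀ τ ∈ 𝔓.inertia (absoluteGaloisGroup ℚ), ψ τ = 1) :
    ∃ (m : ℕ) (_ : NeZero m) (β : (ZMod m)ˣ →* M), Squarefree m ∧ (∀ p : ℕ, p.Prime → p ∣ m → p ∈ S) ∧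
      ∀ σ : absoluteGaloisGroup ℚ, β (modNCyclotomicCharacter ℚ m σ) = ψ σ := by
  obtain ⟨m₀, hm₀, β₀, hβ₀⟩ := Mazur1978.exists_comp_modNCyclotomicCharacter_eq ψ hker
  -- every `β` through which `ψ` factors has values killed by `n` (the cyclotomic character is onto)
  have hkill : ∀ (m : ℕ) [NeZero m] (β : (ZMod m)ˣ →* M),
      (∀ σ : absoluteGaloisGroup ℚ, β (modNCyclotomicCharacter ℚ m σ) = ψ σ) → ∀ x : (ZMod m)ˣ, β x ^ n = 1 := by
    intro m _ β hβ x
    obtain ⟨σ, rfl⟩ := modNCyclotomicCharacter_rat_surjective m x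
    rw [hβ]
    exact hn σ
  -- strong induction on the level
  suffices key : ∀ (m : ℕ) (_ : NeZero m) (β : (ZMod m)ˣ →* M),
      (∀ σ : absoluteGaloisGroup ℚ, β (modNCyclotomicCharacter ℚ m σ) = ψ σ) →
      ∃ (m' : ℕ) (_ : NeZero m') (β' : (ZMod m')ˣ →* M), Squarefree m' ∧ (∀ p : ℕ, p.Prime → p ∣ m' → p ∈ S) ∧
        ∀ σ : absoluteGaloisGroup ℚ, β' (modNCyclotomicCharacter ℚ m' σ) = ψ σ from key m₀ hm₀ β₀ hβ₀
  intro m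
  induction m using Nat.strong_induction_on with
  | _ m ih =>
    intro hm β hβ
    by_cases h1 : ∃ p : ℕ, p.Prime ∧ p ∣ m ∧ p ∉ S
    · -- strip a prime outside `S` (§1)
      obtain ⟨p, hp, hpm, hpS⟩ := h1
      haveI : Fact p.Prime := ⟨hp⟩
      obtain ⟨e, d, hd, hme⟩ := Nat.exists_eq_pow_mul_and_not_dvd (NeZero.ne m) p hp.one_lt.ne'
      obtain ⟨k, rfl⟩ : ∃ k, e = k + 1 := by
        rcases Nat.eq_zero_or_pos e with h0 | h0
        · exfalso
          rw [hme, h0, pow_zero, one_mul] at hpm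
          exact hd hpm
        · exact ⟨e - 1, by omega⟩
      obtain ⟨hd0, β', hβ'⟩ := exists_factor_level_of_unramified ψ β hβ hme hd (hunr p hp hpS)
      have hlt : d < m := by
        have hd1 : 0 < d := Nat.pos_of_ne_zero (NeZero.ne d)
        have hp2 : 2 ≤ p ^ (k + 1) := le_trans hp.two_le (Nat.le_self_pow (Nat.succ_ne_zero k) p)
        rw [hme]
        nlinarith
      exact ih d hlt hd0 β' hβ'
    · push Not at h1
      by_cases h2 : Squarefree m
      · exact ⟨m, hm, β, h2, fun p hp hpm => h1 p hp hpm, hβ⟩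
      · -- strip a repeated prime of `S` (§2)
        obtain ⟨p, hp, hpm⟩ : ∃ p : ℕ, p.Prime ∧ p * p ∣ m := by
          by_contra hc
          push Not at hc
          exact h2 (Nat.squarefree_iff_prime_squarefree.mpr hc)
        have hpS : p ∈ S := h1 p hp (dvd_trans (Dvd.intro p rfl) hpm)
        obtain ⟨e, d, hd, hme⟩ := Nat.exists_eq_pow_mul_and_not_dvd (NeZero.ne m) p hp.one_lt.ne'
        obtain ⟨k, rfl⟩ : ∃ k, e = k + 2 := by
          rcases Nat.lt_or_ge e 2 with h0 | h0
          · exfalso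
            have hcop : (p * p).Coprime d :=
              Nat.Coprime.mul_left ((Nat.Prime.coprime_iff_not_dvd hp).mpr hd) ((Nat.Prime.coprime_iff_not_dvd hp).mpr hd)
            have hdvd' : p * p ∣ p ^ e := by
              have h := (hcop.dvd_mul_right).mp (hme ▸ hpm)
              exact h
            have hle := Nat.le_of_dvd (pow_pos hp.pos e) hdvd'
            interval_cases e
            · rw [pow_zero] at hle; nlinarith [hp.two_le]
            · rw [pow_one] at hle; nlinarith [hp.two_le]
          · exact ⟨e - 2, by omega⟩
        obtain ⟨hpd, β', -, hβ'⟩ := exists_factor_level_of_pow_eq_one ψ β hβ (hkill m β hβ) hp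
          (show m = p ^ ((k + 1) + 1) * d by rw [hme]) hd (hS p hpS)
        have hlt : p * d < m := by
          have hd1 : 0 < d := Nat.pos_of_ne_zero fun h0 => NeZero.ne m (by rw [hme, h0, mul_zero])
          have hppow : p < p ^ (k + 2) := by
            calc p = p ^ 1 := (pow_one p).symm
              _ < p ^ (k + 2) := Nat.pow_lt_pow_right hp.one_lt (by omega)
          rw [hme]
          exact Nat.mul_lt_mul_of_pos_right hppow hd1
        exact ih (p * d) hlt hpd β' hβ'

/-! ### §4 `−3` is a square modulo a squarefree product of primes `≡ 1 (mod 3)` -/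

/-- **`−3` is a quadratic residue modulo every squarefree `m` all of whose prime factors are `≡ 1 (mod 3)`** (each such prime is
`≥ 7` and `≡ 1 (mod 6)`, so `−3` is a square mod `p` by Hardy–Wright Thm. 96 — the tree's `SmallQuadraticResidues.isSquare_neg_three_iff`
— and the Chinese remainder theorem glues). [cite: HardyWright2008, Thm 96] -/
theorem isSquare_neg_three_zmod_of_squarefree :
    ∀ (m : ℕ), Squarefree m → (∀ p : ℕ, p.Prime → p ∣ m → p % 3 = 1) → IsSquare (-3 : ZMod m) := by
  intro m
  induction m using Nat.strong_induction_on with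
  | _ m ih =>
    intro hsq hS
    rcases Nat.lt_or_ge m 2 with hm | hm
    · interval_cases m
      · exact absurd hsq not_squarefree_zero
      · exact ⟨0, Subsingleton.elim _ _⟩
    · -- split off the least prime factor
      have hp : m.minFac.Prime := Nat.minFac_prime (by omega)
      obtain ⟨d, hmd⟩ := Nat.minFac_dvd m
      set p := m.minFac with hpdef
      have hpd : ¬ p ∣ d := by
        intro h
        obtain ⟨c, rfl⟩ := h
        have : p * p ∣ m := ⟨c, by rw [hmd]; ring⟩
        exact (Nat.squarefree_iff_prime_squarefree.mp hsq) p hp this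
      have hcop : p.Coprime d := (Nat.Prime.coprime_iff_not_dvd hp).mpr hpd
      have hd0 : d ≠ 0 := by rintro rfl; rw [mul_zero] at hmd; omega
      have hdlt : d < m := by
        rw [hmd]
        have := hp.two_le
        have hd1 : 0 < d := Nat.pos_of_ne_zero hd0
        nlinarith
      have hsqd : Squarefree d := by
        rw [hmd] at hsq
        exact Squarefree.of_mul_right hsq
      have hSd : ∀ q : ℕ, q.Prime → q ∣ d → q % 3 = 1 := fun q hq hqd => hS q hq (hmd ▸ dvd_mul_of_dvd_right hqd p)
      obtain ⟨y, hy⟩ := ih d hdlt hsqd hSd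
      -- at the prime `p`: `p ≡ 1 (mod 3)`, so `p ≥ 7`, `p ≡ 1 (mod 6)` and `−3` is a square mod `p`
      have hp3 : p % 3 = 1 := hS p hp (hmd ▸ dvd_mul_right p d)
      have hp4 : p ≠ 4 := by rintro h4; rw [h4] at hp; exact absurd hp (by norm_num)
      have hp2' : p ≠ 2 := by rintro h2; rw [h2] at hp3; omega
      have hodd : p % 2 = 1 := (Nat.Prime.eq_one_or_self_of_dvd hp 2 |> fun h => by
        rcases Nat.even_or_odd p with he | ho
        · exfalso
          obtain ⟨c, hc⟩ := he
          have h2 : 2 ∣ p := ⟨c, by omega⟩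
          rcases (Nat.Prime.eq_one_or_self_of_dvd hp 2 h2) with h | h
          · omega
          · exact hp2' h.symm
        · exact Nat.odd_iff.mp ho)
      have hgt : 3 < p := by have := hp.two_le; omega
      have h6 : p % 6 = 1 := by omega
      haveI : Fact p.Prime := ⟨hp⟩
      obtain ⟨x, hx⟩ := (Literature.NumberTheory.Congruences.SmallQuadraticResidues.isSquare_neg_three_iff hgt).mpr h6
      -- glue by the Chinese remainder theorem
      let e : ZMod (p * d) ≃+* ZMod p × ZMod d := ZMod.chineseRemainder hcop
      refine hmd ▸ ⟨e.symm (x, y), ?_⟩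
      apply e.injective
      rw [map_mul, RingEquiv.apply_symm_apply, Prod.mk_mul_mk, ← hx, ← hy, map_neg, map_ofNat]
      rfl

end Summit.BirchSwinnertonDyer.BirchSwinnertonDyer.Theorems.SchneiderFreeAdditiveX3.GaloisCharacterConductor

end
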